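import Summits.CriticalPhenomena.PercolationContinuityZ3.Theorems.PercNearOneGluingNoHeavyLowerTailSahiOneStepRayleighMatroidDefs
import HarnessLib

/-!
# Minors of Rayleigh families are Rayleigh (probability normalisation, pinned densities)

Support file (prover prim-ineq-prove-3 gen 34; `--supports stmt-CriticalPhenomena-4575`).  For a family `𝓛` of finite subsets
of `ι` and disjoint `A, D ⊆ ι`, the minor `fminor A D 𝓛 = {S ∖ A : S ∈ 𝓛, A ⊆ S, S ∩ D = ∅}` satisfies, for every event `P` not
involving `A`, `μ_p((𝓛/A∖D) ∩ P) = ∏_{A∪D}(1−p_i) · μ_{pin p A D}(𝓛 ∩ P)` (`rmass_fminor_filter`): contracting is pinning the density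
to `1`, deleting is pinning it to `0`.  Hence `IsRayleighFamily 𝓛 → IsRayleighFamily (fminor A D 𝓛)`
(`isRayleighFamily_fminor`, Wagner 2008 Lemma 4.1(a) in probability form, with no limits: the closed cube contains the pinned
vectors), and down-closure (`IsLowerSet`) is inherited (`isLowerSet_fminor`).  No definitions, no named facts, no sorries.
-/

noncomputable section

namespace Summit.CriticalPhenomena.PercolationContinuityZ3.Theorems

namespace SahiOneStep

open Finset

variable {ι : Type*} [Fintype ι] [DecidableEq ι]

/-! ## Weights -/

/-- Weights are nonnegative on the closed cube. [folklore] -/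
theorem rwt_nonneg {p : ι → ℝ} (h0 : ∀ i, 0 ≤ p i) (h1 : ∀ i, p i ≤ 1) (S : Finset ι) : 0 ≤ rwt p S := by
  unfold rwt
  refine Finset.prod_nonneg fun i _ => ?_
  split_ifs
  · exact h0 i
  · linarith [h1 i]

/-- Masses are nonnegative on the closed cube. [folklore] -/
theorem rmass_nonneg {p : ι → ℝ} (h0 : ∀ i, 0 ≤ p i) (h1 : ∀ i, p i ≤ 1) (𝓐 : Finset (Finset ι)) :
    0 ≤ rmass p 𝓐 :=
  Finset.sum_nonneg fun S _ => rwt_nonneg h0 h1 S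

/-- Mass is monotone in the family (closed cube). [folklore] -/
theorem rmass_le_rmass_of_subset {p : ι → ℝ} (h0 : ∀ i, 0 ≤ p i) (h1 : ∀ i, p i ≤ 1) {𝓐 𝓑 : Finset (Finset ι)}
    (h : 𝓐 ⊆ 𝓑) : rmass p 𝓐 ≤ rmass p 𝓑 :=
  Finset.sum_le_sum_of_subset_of_nonneg h fun S _ _ => rwt_nonneg h0 h1 S

omit [Fintype ι] in
/-- Pinned densities stay in the closed cube (lower bound). [this work] -/
theorem pin_nonneg {p : ι → ℝ} (h0 : ∀ i, 0 ≤ p i) (A D : Finset ι) (i : ι) : 0 ≤ pin p A D i := by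
  unfold pin; split_ifs
  · norm_num
  · norm_num
  · exact h0 i

omit [Fintype ι] in
/-- Pinned densities stay in the closed cube (upper bound). [this work] -/
theorem pin_le_one {p : ι → ℝ} (h1 : ∀ i, p i ≤ 1) (A D : Finset ι) (i : ι) : pin p A D i ≤ 1 := by
  unfold pin; split_ifs
  · norm_num
  · norm_num
  · exact h1 i


/-- Split the weight into the factors over `A ∪ D` and the free part. [folklore] -/
theorem rwt_eq_prod_mul_rrest (p : ι → ℝ) (A D S : Finset ι) :
    rwt p S = (∏ i ∈ A ∪ D, (if i ∈ S then p i else 1 - p i)) * rrest p A D S := by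
  unfold rwt rrest
  rw [mul_comm, Finset.prod_sdiff (Finset.subset_univ _)]

/-- Under the pinned densities a set not containing `A`, or meeting `D`, has weight `0`. -/
theorem rwt_pin_eq_zero {p : ι → ℝ} {A D S : Finset ι} (hAD : Disjoint A D) (h : ¬ (A ⊆ S ∧ Disjoint D S)) :
    rwt (pin p A D) S = 0 := by
  unfold rwt
  rw [not_and_or] at h
  rcases h with hA | hD
  · obtain ⟨a, haA, haS⟩ := Finset.not_subset.mp hA
    exact Finset.prod_eq_zero (Finset.mem_univ a) (by simp [pin, haA, haS])
  · obtain ⟨d, hdD, hdS⟩ := Finset.not_disjoint_iff.mp hD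
    have hdA : d ∉ A := fun hdA => Finset.disjoint_left.mp hAD hdA hdD
    exact Finset.prod_eq_zero (Finset.mem_univ d) (by simp [pin, hdA, hdD, hdS])

/-- Under the pinned densities a set `S ⊇ A` avoiding `D` has weight equal to its free part. -/
theorem rwt_pin_eq_rrest {p : ι → ℝ} {A D S : Finset ι} (hAD : Disjoint A D) (hAS : A ⊆ S) (hDS : Disjoint D S) :
    rwt (pin p A D) S = rrest p A D S := by
  rw [rwt_eq_prod_mul_rrest (pin p A D) A D S]
  have h1 : (∏ i ∈ A ∪ D, (if i ∈ S then pin p A D i else 1 - pin p A D i)) = 1 := by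
    refine Finset.prod_eq_one fun i hi => ?_
    rcases Finset.mem_union.mp hi with hiA | hiD
    · simp [pin, hiA, hAS hiA]
    · have hiA : i ∉ A := fun hiA => Finset.disjoint_left.mp hAD hiA hiD
      have hiS : i ∉ S := fun hiS => Finset.disjoint_left.mp hDS hiD hiS
      simp [pin, hiA, hiD, hiS]
  have h2 : rrest (pin p A D) A D S = rrest p A D S := by
    unfold rrest
    refine Finset.prod_congr rfl fun i hi => ?_
    have hi' : i ∉ A ∪ D := (Finset.mem_sdiff.mp hi).2
    have hiA : i ∉ A := fun h => hi' (Finset.mem_union_left _ h)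
    have hiD : i ∉ D := fun h => hi' (Finset.mem_union_right _ h)
    simp [pin, hiA, hiD]
  rw [h1, one_mul, h2]

/-- A set avoiding `A ∪ D` has weight `∏_{A ∪ D}(1 − p_i)` times its free part. -/
theorem rwt_eq_const_mul_rrest {p : ι → ℝ} {A D T : Finset ι} (hT : Disjoint (A ∪ D) T) :
    rwt p T = (∏ i ∈ A ∪ D, (1 - p i)) * rrest p A D T := by
  rw [rwt_eq_prod_mul_rrest p A D T]
  congr 1
  refine Finset.prod_congr rfl fun i hi => ?_
  have hiT : i ∉ T := fun hiT => Finset.disjoint_left.mp hT hi hiT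
  simp [hiT]

/-- The free part only sees the coordinates off `A ∪ D`: removing `A` does not change it. -/
theorem rrest_sdiff (p : ι → ℝ) (A D S : Finset ι) : rrest p A D (S \ A) = rrest p A D S := by
  unfold rrest
  refine Finset.prod_congr rfl fun i hi => ?_
  have hi' : i ∉ A ∪ D := (Finset.mem_sdiff.mp hi).2
  have hiA : i ∉ A := fun h => hi' (Finset.mem_union_left _ h)
  simp [Finset.mem_sdiff, hiA]


/-! ## Minors -/

omit [Fintype ι] in
/-- Membership in the minor `𝓛 / A ∖ D`: the sets avoiding `A ∪ D` whose union with `A` lies in `𝓛`. [folklore] -/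
theorem mem_fminor {A D : Finset ι} (hAD : Disjoint A D) {𝓛 : Finset (Finset ι)} {T : Finset ι} :
    T ∈ fminor A D 𝓛 ↔ Disjoint (A ∪ D) T ∧ T ∪ A ∈ 𝓛 := by
  unfold fminor
  constructor
  · intro h
    obtain ⟨S, hS, rfl⟩ := Finset.mem_image.mp h
    obtain ⟨hS𝓛, hAS, hDS⟩ := Finset.mem_filter.mp hS
    refine ⟨?_, ?_⟩
    · rw [Finset.disjoint_union_left]
      exact ⟨Finset.disjoint_sdiff, Finset.disjoint_of_subset_right Finset.sdiff_subset hDS⟩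
    · rwa [Finset.sdiff_union_of_subset hAS]
  · rintro ⟨hT, hTA⟩
    rw [Finset.disjoint_union_left] at hT
    refine Finset.mem_image.mpr ⟨T ∪ A, Finset.mem_filter.mpr ⟨hTA, Finset.subset_union_right, ?_⟩, ?_⟩
    · rw [Finset.disjoint_union_right]; exact ⟨hT.2, hAD.symm⟩
    · rw [Finset.union_sdiff_right, Finset.sdiff_eq_self_of_disjoint hT.1.symm]

omit [Fintype ι] in
/-- Members of the minor avoid `A ∪ D`. [folklore] -/
theorem disjoint_of_mem_fminor {A D : Finset ι} {𝓛 : Finset (Finset ι)} {T : Finset ι} (h : T ∈ fminor A D 𝓛) :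
    Disjoint (A ∪ D) T := by
  unfold fminor at h
  obtain ⟨S, hS, rfl⟩ := Finset.mem_image.mp h
  obtain ⟨-, -, hDS⟩ := Finset.mem_filter.mp hS
  rw [Finset.disjoint_union_left]
  exact ⟨Finset.disjoint_sdiff, Finset.disjoint_of_subset_right Finset.sdiff_subset hDS⟩

omit [Fintype ι] in
/-- Minors of down-closed families are down-closed. [folklore] -/
theorem isLowerSet_fminor {𝓛 : Finset (Finset ι)} (h𝓛 : IsLowerSet (𝓛 : Set (Finset ι))) {A D : Finset ι}
    (hAD : Disjoint A D) : IsLowerSet (fminor A D 𝓛 : Set (Finset ι)) := by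
  intro T T' hT'T hT
  rw [Finset.mem_coe, mem_fminor hAD] at hT ⊢
  exact ⟨Finset.disjoint_of_subset_right hT'T hT.1, h𝓛 (Finset.union_subset_union hT'T le_rfl) hT.2⟩

/-- Mass of the minor vs. pinned mass of the family, for events not involving `A` (hypothesis `hP`). -/
theorem rmass_fminor_filter {𝓛 : Finset (Finset ι)} {A D : Finset ι} (hAD : Disjoint A D) (p : ι → ℝ)
    (P : Finset ι → Prop) [DecidablePred P] (hP : ∀ S, A ⊆ S → (P S ↔ P (S \ A))) :
    rmass p ((fminor A D 𝓛).filter P) = (∏ i ∈ A ∪ D, (1 - p i)) * rmass (pin p A D) (𝓛.filter P) := by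
  classical
  -- left side: constant times the free parts
  have hL : rmass p ((fminor A D 𝓛).filter P) =
      (∏ i ∈ A ∪ D, (1 - p i)) * ∑ T ∈ (fminor A D 𝓛).filter P, rrest p A D T := by
    unfold rmass
    rw [Finset.mul_sum]
    refine Finset.sum_congr rfl fun T hT => ?_
    exact rwt_eq_const_mul_rrest (disjoint_of_mem_fminor (Finset.mem_filter.mp hT).1)
  -- right side: only sets `S ⊇ A` avoiding `D` contribute, with their free parts
  have hR : rmass (pin p A D) (𝓛.filter P) =
      ∑ S ∈ (𝓛.filter fun S => A ⊆ S ∧ Disjoint D S).filter P, rrest p A D S := by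
    unfold rmass
    rw [Finset.filter_filter]
    rw [← Finset.sum_filter_add_sum_filter_not (𝓛.filter P) (fun S => A ⊆ S ∧ Disjoint D S)]
    have hzero : ∑ S ∈ (𝓛.filter P).filter (fun S => ¬ (A ⊆ S ∧ Disjoint D S)), rwt (pin p A D) S = 0 :=
      Finset.sum_eq_zero fun S hS => rwt_pin_eq_zero hAD (Finset.mem_filter.mp hS).2
    rw [hzero, add_zero, Finset.filter_filter]
    have hsets : (𝓛.filter fun S => P S ∧ (A ⊆ S ∧ Disjoint D S)) = 𝓛.filter fun S => (A ⊆ S ∧ Disjoint D S) ∧ P S :=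
      Finset.filter_congr fun S _ => by tauto
    rw [hsets]
    refine Finset.sum_congr rfl fun S hS => ?_
    obtain ⟨-, ⟨hAS, hDS⟩, -⟩ := Finset.mem_filter.mp hS
    exact rwt_pin_eq_rrest hAD hAS hDS
  -- reindex the right side along `S ↦ S \ A`
  have hre : ∑ T ∈ (fminor A D 𝓛).filter P, rrest p A D T =
      ∑ S ∈ (𝓛.filter fun S => A ⊆ S ∧ Disjoint D S).filter P, rrest p A D S := by
    unfold fminor
    rw [Finset.filter_image]
    rw [Finset.sum_image]
    · have hsets : ((𝓛.filter fun S => A ⊆ S ∧ Disjoint D S).filter fun S => P (S \ A)) =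
          (𝓛.filter fun S => A ⊆ S ∧ Disjoint D S).filter P :=
        Finset.filter_congr fun S hS => (hP S (Finset.mem_filter.mp hS).2.1).symm
      rw [hsets]
      exact Finset.sum_congr rfl fun S _ => rrest_sdiff p A D S
    · intro S hS S' hS' hSS'
      have hSS'' : S \ A = S' \ A := hSS'
      have hAS : A ⊆ S := (Finset.mem_filter.mp (Finset.mem_filter.mp hS).1).2.1
      have hAS' : A ⊆ S' := (Finset.mem_filter.mp (Finset.mem_filter.mp hS').1).2.1
      rw [← Finset.sdiff_union_of_subset hAS, ← Finset.sdiff_union_of_subset hAS', hSS'']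
  rw [hL, hre, hR]

/-- **Minors of Rayleigh families are Rayleigh** [Wagner2008, Lemma 4.1(a)] (probability form, pinned densities). -/
theorem isRayleighFamily_fminor {𝓛 : Finset (Finset ι)} (h𝓛 : IsRayleighFamily 𝓛) {A D : Finset ι} (hAD : Disjoint A D) :
    IsRayleighFamily (fminor A D 𝓛) := by
  classical
  intro p h0 h1 e f hef
  set c : ℝ := ∏ i ∈ A ∪ D, (1 - p i) with hc
  by_cases he : e ∈ A ∪ D
  · have hempty : (fminor A D 𝓛).filter (fun S => e ∈ S ∧ f ∈ S) = ∅ := by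
      refine Finset.filter_eq_empty_iff.mpr fun T hT hT' => ?_
      exact Finset.disjoint_left.mp (disjoint_of_mem_fminor hT) he hT'.1
    rw [hempty]; unfold rmass; rw [Finset.sum_empty, zero_mul]
    exact mul_nonneg (rmass_nonneg h0 h1 _) (rmass_nonneg h0 h1 _)
  by_cases hf : f ∈ A ∪ D
  · have hempty : (fminor A D 𝓛).filter (fun S => e ∈ S ∧ f ∈ S) = ∅ := by
      refine Finset.filter_eq_empty_iff.mpr fun T hT hT' => ?_
      exact Finset.disjoint_left.mp (disjoint_of_mem_fminor hT) hf hT'.2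
    rw [hempty]; unfold rmass; rw [Finset.sum_empty, zero_mul]
    exact mul_nonneg (rmass_nonneg h0 h1 _) (rmass_nonneg h0 h1 _)
  have heA : e ∉ A := fun h => he (Finset.mem_union_left _ h)
  have hfA : f ∉ A := fun h => hf (Finset.mem_union_left _ h)
  have H := h𝓛 (pin p A D) (pin_nonneg h0 A D) (pin_le_one h1 A D) e f hef
  have hPef : ∀ S : Finset ι, A ⊆ S → ((e ∈ S ∧ f ∈ S) ↔ (e ∈ S \ A ∧ f ∈ S \ A)) := fun S _ => by
    simp [Finset.mem_sdiff, heA, hfA]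
  have hPe : ∀ S : Finset ι, A ⊆ S → (e ∈ S ↔ e ∈ S \ A) := fun S _ => by simp [Finset.mem_sdiff, heA]
  have hPf : ∀ S : Finset ι, A ⊆ S → (f ∈ S ↔ f ∈ S \ A) := fun S _ => by simp [Finset.mem_sdiff, hfA]
  have hPt : ∀ S : Finset ι, A ⊆ S → (True ↔ True) := fun _ _ => Iff.rfl
  have hall : rmass p (fminor A D 𝓛) = c * rmass (pin p A D) 𝓛 := by
    have h := rmass_fminor_filter (𝓛 := 𝓛) hAD p (fun _ => True) hPt
    simp only [Finset.filter_true] at h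
    exact h
  rw [rmass_fminor_filter hAD p _ hPef, rmass_fminor_filter hAD p _ hPe, rmass_fminor_filter hAD p _ hPf, hall]
  have hc0 : 0 ≤ c := Finset.prod_nonneg fun i _ => by linarith [h1 i]
  have key : c * c * (rmass (pin p A D) (𝓛.filter fun S => e ∈ S ∧ f ∈ S) * rmass (pin p A D) 𝓛) ≤
      c * c * (rmass (pin p A D) (𝓛.filter fun S => e ∈ S) * rmass (pin p A D) (𝓛.filter fun S => f ∈ S)) :=
    mul_le_mul_of_nonneg_left H (mul_nonneg hc0 hc0)
  calc c * rmass (pin p A D) (𝓛.filter fun S => e ∈ S ∧ f ∈ S) * (c * rmass (pin p A D) 𝓛)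
      = c * c * (rmass (pin p A D) (𝓛.filter fun S => e ∈ S ∧ f ∈ S) * rmass (pin p A D) 𝓛) := by ring
    _ ≤ c * c * (rmass (pin p A D) (𝓛.filter fun S => e ∈ S) * rmass (pin p A D) (𝓛.filter fun S => f ∈ S)) := key
    _ = c * rmass (pin p A D) (𝓛.filter fun S => e ∈ S) * (c * rmass (pin p A D) (𝓛.filter fun S => f ∈ S)) := by
        ring

end SahiOneStep

end Summit.CriticalPhenomena.PercolationContinuityZ3.Theorems
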